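import Mathlib

/-!
# P2 `stub_pair_middle` — boxes and shells: the per-box reduction (pure counting)

Auxiliary stub `stub_pair_middle_box_reduction` of the line `eta-free-multilinear-window`
(crux `PolyMobiusTail`), supporting the middle-range stub `stub_pair_middle` (dispersion for the
`k = 2` linear window).  In the `(d₀, d₁, m)`-parametrisation of the one-sided middle sum of a pair
`(q₀X + a₀, q₁X + a₁)` (`n = (d₁m − a₁)/q₁`), fix a box `lo < d₁ ≤ hi` with `lo` large.  The TRUE
summation conditions (C1: `q₁ ∣ d₁m − a₁`; C3: `1 ≤ n ≤ x`; C2⁺: `1 ≤ q₀n + a₀`; C2: `d₀ ∣ q₀n + a₀`;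
the window `x^{1-η} < d₀d₁ ≤ x^{1+θ}`; C5: `x^{σ₁} < d₀ ≤ x^{σ₂}`) and the BOX conditions (C1;
C2': `q₁d₀ ∣ q₀d₁m + Δ'`, `Δ' = q₁a₀ − q₀a₁`; `x^{1-η}/lo < d₀ ≤ x^{1+θ}/hi`; C5; `m ≤ (q₁x+a₁)/hi`)
satisfy BOX ⟹ TRUE and TRUE ∧ ¬BOX ⟹ one of three boundary shells; since the weight
`μ(d₀) log d₀ · μ(d₁) log d₁` is at most `(log Xb)² ≤ (1 + log Xb)²` in absolute value, the two
weighted sums differ by at most `(1 + log Xb)²` times the number of TRUE configurations in a shell.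
Everything here is elementary counting; no analytic input.
-/

open scoped BigOperators
open Filter Finset Polynomial Asymptotics

namespace Summit.Parity.BatemanHorn.Theorems.PolyMobiusTail.EtaFreeWindow

/-- Abstract form of the reduction: for predicates `T` (true), `B` (box), `F` (shell filter) on a
finset with `B → T` and `T ∧ ¬B → F`, and a weight bounded by `L ≥ 0` on `T`, the `T`-sum and the
`B`-sum of the weight differ by at most `L · #{F}`. -/
theorem abs_sum_ite_sub_sum_ite_le_mul_card {ι : Type*} (s : Finset ι) (T B F : ι → Prop)
    [DecidablePred T] [DecidablePred B] [DecidablePred F] (w : ι → ℝ) {L : ℝ} (hL : 0 ≤ L)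
    (hBT : ∀ i ∈ s, B i → T i) (hTF : ∀ i ∈ s, T i → ¬ B i → F i)
    (hw : ∀ i ∈ s, T i → |w i| ≤ L) :
    |(∑ i ∈ s, if T i then w i else 0) - ∑ i ∈ s, if B i then w i else 0| ≤
      L * ((s.filter F).card : ℝ) := by
  rw [← Finset.sum_sub_distrib]
  refine (Finset.abs_sum_le_sum_abs _ _).trans ?_
  have key : ∀ i ∈ s, |(if T i then w i else 0) - (if B i then w i else 0)| ≤
      if F i then L else 0 := by
    intro i hi
    by_cases hB : B i
    · rw [if_pos (hBT i hi hB), if_pos hB, sub_self, abs_zero]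
      split_ifs
      · exact hL
      · exact le_rfl
    · by_cases hT : T i
      · rw [if_pos hT, if_neg hB, sub_zero, if_pos (hTF i hi hT hB)]
        exact hw i hi hT
      · rw [if_neg hT, if_neg hB, sub_zero, abs_zero]
        split_ifs
        · exact hL
        · exact le_rfl
  refine (Finset.sum_le_sum key).trans ?_
  rw [← Finset.sum_filter, Finset.sum_const, nsmul_eq_mul, mul_comm]

/-- An iterated triple sum over `A`, `B`, `C` is the sum over the product finset `(A ×ˢ B) ×ˢ C`. -/
theorem sum_sum_sum_eq_sum_product (A B C : Finset ℕ) (g : ℕ → ℕ → ℕ → ℝ) :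
    ∑ a ∈ A, ∑ b ∈ B, ∑ c ∈ C, g a b c = ∑ t ∈ (A ×ˢ B) ×ˢ C, g t.1.1 t.1.2 t.2 := by
  rw [Finset.sum_product, Finset.sum_product]

/-- The weight bound: for `1 ≤ d₀ ≤ Xb` and `1 ≤ d₁ ≤ Xb`,
`|μ(d₀) log d₀ · μ(d₁) log d₁| ≤ (1 + log Xb)²`. -/
theorem abs_moebius_log_mul_le {d₀ d₁ Xb : ℕ} (h₀ : 1 ≤ d₀) (h₀' : d₀ ≤ Xb) (h₁ : 1 ≤ d₁)
    (h₁' : d₁ ≤ Xb) :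
    |((ArithmeticFunction.moebius d₀ : ℝ) * Real.log d₀) *
        ((ArithmeticFunction.moebius d₁ : ℝ) * Real.log d₁)| ≤ (1 + Real.log Xb) ^ 2 := by
  have hμ : ∀ d : ℕ, |(ArithmeticFunction.moebius d : ℝ)| ≤ 1 := by
    intro d
    have h := ArithmeticFunction.abs_moebius_le_one (n := d)
    have : (|(ArithmeticFunction.moebius d : ℤ)| : ℝ) ≤ ((1 : ℤ) : ℝ) := by exact_mod_cast h
    simpa [Int.cast_abs] using this
  have hlog : ∀ d : ℕ, 1 ≤ d → d ≤ Xb → |Real.log d| ≤ 1 + Real.log Xb := by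
    intro d hd hdX
    have hd1 : (1 : ℝ) ≤ d := by exact_mod_cast hd
    have hdX' : (d : ℝ) ≤ Xb := by exact_mod_cast hdX
    rw [abs_of_nonneg (Real.log_nonneg hd1)]
    have := Real.log_le_log (by linarith) hdX'
    linarith
  have hX1 : (1 : ℝ) ≤ Xb := by exact_mod_cast h₀.trans h₀'
  have hL0 : 0 ≤ 1 + Real.log Xb := by have := Real.log_nonneg hX1; linarith
  rw [abs_mul, abs_mul, abs_mul]
  have h0 : |(ArithmeticFunction.moebius d₀ : ℝ)| * |Real.log d₀| ≤ 1 * (1 + Real.log Xb) :=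
    mul_le_mul (hμ d₀) (hlog d₀ h₀ h₀') (abs_nonneg _) zero_le_one
  have h1 : |(ArithmeticFunction.moebius d₁ : ℝ)| * |Real.log d₁| ≤ 1 * (1 + Real.log Xb) :=
    mul_le_mul (hμ d₁) (hlog d₁ h₁ h₁') (abs_nonneg _) zero_le_one
  calc |(ArithmeticFunction.moebius d₀ : ℝ)| * |Real.log d₀| *
        (|(ArithmeticFunction.moebius d₁ : ℝ)| * |Real.log d₁|)
      ≤ 1 * (1 + Real.log Xb) * (1 * (1 + Real.log Xb)) :=
        mul_le_mul h0 h1 (mul_nonneg (abs_nonneg _) (abs_nonneg _)) (by positivity)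
    _ = (1 + Real.log Xb) ^ 2 := by ring


/-- **O2-BX (per-box reduction, pure counting).**  Fix the pair data `q₀,a₀,q₁,a₁` (`qᵢ ≥ 1`), the
exponents, `x`, a bound `Xb`, and a box `lo < d₁ ≤ hi ≤ Xb` with `lo` large
(`q₁ + |a₁| + q₁(|a₀|+1) + 2 ≤ lo`).  The TRUE per-box `(d₀,d₁,m)`-sum (conditions C1, C3, C2⁺, C2,
window, C5 of the triple sum) and the BOX sum (conditions C1, `q₁d₀ ∣ q₀d₁m + Δ'`,
`x^{1-η}/lo < d₀ ≤ x^{1+θ}/hi`, C5, `m ≤ (q₁x+a₁)/hi`) differ by at most `(1 + log Xb)²` times the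
number of TRUE configurations of the box lying in one of the three shells
`d₀d₁ ∈ (x^{1-η}, x^{1-η}·hi/lo]`, `d₀d₁ ∈ (x^{1+θ}·lo/hi, x^{1+θ}]`, `d₁m > (q₁x+a₁)·lo/hi`. -/
theorem stub_pair_middle_box_reduction :
    ∀ (q₀ a₀ q₁ a₁ : ℤ) (σ₁ σ₂ θ η : ℝ) (x Xb lo hi : ℕ), 0 < q₀ → 0 < q₁ →
      (q₁.toNat + a₁.natAbs + q₁.toNat * (a₀.natAbs + 1) + 2 ≤ lo) → lo < hi → hi ≤ Xb →
      |(∑ d₀ ∈ Finset.Icc 1 Xb, ∑ d₁ ∈ Finset.Ioc lo hi, ∑ m ∈ Finset.Icc 1 Xb,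
          if ((d₁ : ℤ) * m - a₁) % q₁ = 0 ∧
              (1 ≤ ((d₁ : ℤ) * m - a₁) / q₁ ∧ ((d₁ : ℤ) * m - a₁) / q₁ ≤ x) ∧
              (1 ≤ q₀ * (((d₁ : ℤ) * m - a₁) / q₁) + a₀ ∧ (d₀ : ℤ) ∣ q₀ * (((d₁ : ℤ) * m - a₁) / q₁) + a₀) ∧
              ((x : ℝ) ^ (1 - η) < (d₀ : ℝ) * d₁ ∧ (d₀ : ℝ) * d₁ ≤ (x : ℝ) ^ (1 + θ) ∧
                ((x : ℝ) ^ σ₁ < (d₀ : ℝ) ∧ (d₀ : ℝ) ≤ (x : ℝ) ^ σ₂)) then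
            ((ArithmeticFunction.moebius d₀ : ℝ) * Real.log d₀) *
              ((ArithmeticFunction.moebius d₁ : ℝ) * Real.log d₁) else 0) -
        (∑ d₀ ∈ Finset.Icc 1 Xb, ∑ d₁ ∈ Finset.Ioc lo hi, ∑ m ∈ Finset.Icc 1 Xb,
          if ((d₁ : ℤ) * m - a₁) % q₁ = 0 ∧
              (q₁ * (d₀ : ℤ) ∣ q₀ * ((d₁ : ℤ) * m) + (q₁ * a₀ - q₀ * a₁)) ∧
              ((x : ℝ) ^ (1 - η) / lo < (d₀ : ℝ) ∧ (d₀ : ℝ) ≤ (x : ℝ) ^ (1 + θ) / hi ∧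
                ((x : ℝ) ^ σ₁ < (d₀ : ℝ) ∧ (d₀ : ℝ) ≤ (x : ℝ) ^ σ₂)) ∧
              ((m : ℝ) ≤ ((q₁ : ℝ) * x + a₁) / hi) then
            ((ArithmeticFunction.moebius d₀ : ℝ) * Real.log d₀) *
              ((ArithmeticFunction.moebius d₁ : ℝ) * Real.log d₁) else 0)| ≤
      (1 + Real.log Xb) ^ 2 *
        (((Finset.Icc 1 Xb ×ˢ Finset.Ioc lo hi) ×ˢ Finset.Icc 1 Xb).filter (fun c : (ℕ × ℕ) × ℕ =>
          (((c.1.2 : ℤ) * c.2 - a₁) % q₁ = 0 ∧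
            (1 ≤ ((c.1.2 : ℤ) * c.2 - a₁) / q₁ ∧ ((c.1.2 : ℤ) * c.2 - a₁) / q₁ ≤ x) ∧
            (1 ≤ q₀ * (((c.1.2 : ℤ) * c.2 - a₁) / q₁) + a₀ ∧
              (c.1.1 : ℤ) ∣ q₀ * (((c.1.2 : ℤ) * c.2 - a₁) / q₁) + a₀)) ∧
          (((x : ℝ) ^ (1 - η) < (c.1.1 : ℝ) * c.1.2 ∧ (c.1.1 : ℝ) * c.1.2 ≤ (x : ℝ) ^ (1 - η) * hi / lo) ∨
           ((x : ℝ) ^ (1 + θ) * lo / hi < (c.1.1 : ℝ) * c.1.2 ∧ (c.1.1 : ℝ) * c.1.2 ≤ (x : ℝ) ^ (1 + θ)) ∨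
           (((q₁ : ℝ) * x + a₁) * lo / hi < (c.1.2 : ℝ) * c.2)))).card := by
  intro q₀ a₀ q₁ a₁ σ₁ σ₂ θ η x Xb lo hi hq₀ hq₁ hlo hlohi hhiXb
  rw [sum_sum_sum_eq_sum_product, sum_sum_sum_eq_sum_product]
  have hlo2 : 2 ≤ lo := le_trans (Nat.le_add_left 2 _) hlo
  have hXb1 : 1 ≤ Xb := by omega
  have hLnonneg : 0 ≤ (1 + Real.log Xb) ^ 2 := by positivity
  -- casts of the size hypothesis on `lo`
  have hq₁nat : (q₁.toNat : ℤ) = q₁ := Int.toNat_of_nonneg hq₁.le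
  have hloZ : q₁ + |a₁| + q₁ * (|a₀| + 1) + 2 ≤ (lo : ℤ) := by
    have h := hlo
    zify at h
    rw [hq₁nat] at h
    simpa using h
  have hloR : (0 : ℝ) < lo := by exact_mod_cast (show 0 < lo by omega)
  have hhiR : (0 : ℝ) < hi := by exact_mod_cast (show 0 < hi by omega)
  refine abs_sum_ite_sub_sum_ite_le_mul_card _ _ _ _ _ hLnonneg ?_ ?_ ?_
  · -- BOX ⟹ TRUE
    rintro ⟨⟨d₀, d₁⟩, m⟩ hmem ⟨hC1, hC2', ⟨hBlo, hBhi, hC5⟩, hBm⟩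
    simp only [Finset.mem_product, Finset.mem_Icc, Finset.mem_Ioc] at hmem
    obtain ⟨⟨⟨hd₀1, hd₀X⟩, hd₁lo, hd₁hi⟩, hm1, hmX⟩ := hmem
    dsimp only at hC1 hC2' hBlo hBhi hC5 hBm ⊢
    set n : ℤ := ((d₁ : ℤ) * m - a₁) / q₁ with hn
    have hqn : q₁ * n = (d₁ : ℤ) * m - a₁ := Int.mul_ediv_cancel' (Int.dvd_of_emod_eq_zero hC1)
    have hd₁loZ : (lo : ℤ) + 1 ≤ d₁ := by exact_mod_cast hd₁lo
    have hm1Z : (1 : ℤ) ≤ m := by exact_mod_cast hm1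
    have hdm : (lo : ℤ) + 1 ≤ (d₁ : ℤ) * m := by nlinarith
    have ha₁ : a₁ ≤ |a₁| := le_abs_self _
    have ha₀ : -a₀ ≤ |a₀| := neg_le_abs _
    have ha₀' : 0 ≤ |a₀| := abs_nonneg _
    -- C3 lower bound: `n ≥ |a₀| + 3`
    have hnlb : |a₀| + 3 ≤ n := by
      by_contra h
      push Not at h
      have : q₁ * n ≤ q₁ * (|a₀| + 2) := by
        exact mul_le_mul_of_nonneg_left (by omega) hq₁.le
      nlinarith
    -- C3 upper bound from `Bm`
    have hnx : n ≤ x := by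
      have h1 : (m : ℝ) * hi ≤ (q₁ : ℝ) * x + a₁ := (le_div_iff₀ hhiR).1 hBm
      have h2 : (d₁ : ℝ) * m ≤ (hi : ℝ) * m := by
        have : (d₁ : ℝ) ≤ hi := by exact_mod_cast hd₁hi
        have hm0 : (0 : ℝ) ≤ m := by positivity
        exact mul_le_mul_of_nonneg_right this hm0
      have h3 : (d₁ : ℝ) * m ≤ (q₁ : ℝ) * x + a₁ := by linarith [mul_comm (hi : ℝ) m]
      have h4 : (d₁ : ℤ) * m ≤ q₁ * x + a₁ := by exact_mod_cast h3
      have h5 : q₁ * n ≤ q₁ * x := by linarith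
      exact le_of_mul_le_mul_left h5 hq₁
    refine ⟨hC1, ⟨by linarith, hnx⟩, ⟨by nlinarith, ?_⟩, ?_, ?_, hC5⟩
    · -- C2 from C2'
      have : q₁ * (d₀ : ℤ) ∣ q₁ * (q₀ * n + a₀) := by
        have e : q₁ * (q₀ * n + a₀) = q₀ * ((d₁ : ℤ) * m) + (q₁ * a₀ - q₀ * a₁) := by
          linear_combination q₀ * hqn
        rw [e]; exact hC2'
      exact (mul_dvd_mul_iff_left hq₁.ne').1 this
    · -- window, lower
      have h1 : (x : ℝ) ^ (1 - η) < (d₀ : ℝ) * lo := (div_lt_iff₀ hloR).1 hBlo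
      have h2 : (d₀ : ℝ) * lo ≤ (d₀ : ℝ) * d₁ := by
        have : (lo : ℝ) ≤ d₁ := by exact_mod_cast hd₁lo.le
        exact mul_le_mul_of_nonneg_left this (by positivity)
      linarith
    · -- window, upper
      have h1 : (d₀ : ℝ) * hi ≤ (x : ℝ) ^ (1 + θ) := (le_div_iff₀ hhiR).1 hBhi
      have h2 : (d₀ : ℝ) * d₁ ≤ (d₀ : ℝ) * hi := by
        have : (d₁ : ℝ) ≤ hi := by exact_mod_cast hd₁hi
        exact mul_le_mul_of_nonneg_left this (by positivity)
      linarith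
  · -- TRUE ∧ ¬ BOX ⟹ shell filter
    rintro ⟨⟨d₀, d₁⟩, m⟩ hmem ⟨hC1, hC3, ⟨hC2p, hC2⟩, hWlo, hWhi, hC5⟩ hnB
    simp only [Finset.mem_product, Finset.mem_Icc, Finset.mem_Ioc] at hmem
    obtain ⟨⟨⟨hd₀1, hd₀X⟩, hd₁lo, hd₁hi⟩, hm1, hmX⟩ := hmem
    dsimp only at hC1 hC3 hC2p hC2 hWlo hWhi hC5 hnB ⊢
    refine ⟨⟨hC1, hC3, hC2p, hC2⟩, ?_⟩
    set n : ℤ := ((d₁ : ℤ) * m - a₁) / q₁ with hn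
    have hqn : q₁ * n = (d₁ : ℤ) * m - a₁ := Int.mul_ediv_cancel' (Int.dvd_of_emod_eq_zero hC1)
    have hC2' : q₁ * (d₀ : ℤ) ∣ q₀ * ((d₁ : ℤ) * m) + (q₁ * a₀ - q₀ * a₁) := by
      have e : q₀ * ((d₁ : ℤ) * m) + (q₁ * a₀ - q₀ * a₁) = q₁ * (q₀ * n + a₀) := by
        linear_combination -q₀ * hqn
      rw [e]; exact mul_dvd_mul_left q₁ hC2
    have hd₁R : (lo : ℝ) < d₁ := by exact_mod_cast hd₁lo
    have hd₁R' : (d₁ : ℝ) ≤ hi := by exact_mod_cast hd₁hi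
    have hd₀R : (0 : ℝ) < d₀ := by exact_mod_cast hd₀1
    have hd₁pos : (0 : ℝ) < d₁ := hloR.trans hd₁R
    have hmR : (0 : ℝ) < m := by exact_mod_cast hm1
    by_cases hBlo : (x : ℝ) ^ (1 - η) / lo < (d₀ : ℝ)
    · by_cases hBhi : (d₀ : ℝ) ≤ (x : ℝ) ^ (1 + θ) / hi
      · by_cases hBm : (m : ℝ) ≤ ((q₁ : ℝ) * x + a₁) / hi
        · exact absurd ⟨hC1, hC2', ⟨hBlo, hBhi, hC5⟩, hBm⟩ hnB
        · -- shell₃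
          right; right
          push Not at hBm
          calc ((q₁ : ℝ) * x + a₁) * lo / hi = ((q₁ : ℝ) * x + a₁) / hi * lo := by ring
            _ < (m : ℝ) * lo := mul_lt_mul_of_pos_right hBm hloR
            _ ≤ (m : ℝ) * d₁ := mul_le_mul_of_nonneg_left hd₁R.le hmR.le
            _ = (d₁ : ℝ) * m := by ring
      · -- shell₂
        right; left
        push Not at hBhi
        refine ⟨?_, hWhi⟩
        have h0 : 0 ≤ (x : ℝ) ^ (1 + θ) / hi := by positivity
        calc (x : ℝ) ^ (1 + θ) * lo / hi = (x : ℝ) ^ (1 + θ) / hi * lo := by ring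
          _ ≤ (x : ℝ) ^ (1 + θ) / hi * d₁ := mul_le_mul_of_nonneg_left hd₁R.le h0
          _ < (d₀ : ℝ) * d₁ := mul_lt_mul_of_pos_right hBhi hd₁pos
    · -- shell₁
      left
      push Not at hBlo
      refine ⟨hWlo, ?_⟩
      have h0 : 0 ≤ (x : ℝ) ^ (1 - η) / lo := by positivity
      calc (d₀ : ℝ) * d₁ ≤ (x : ℝ) ^ (1 - η) / lo * d₁ := mul_le_mul_of_nonneg_right hBlo hd₁pos.le
        _ ≤ (x : ℝ) ^ (1 - η) / lo * hi := mul_le_mul_of_nonneg_left hd₁R' h0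
        _ = (x : ℝ) ^ (1 - η) * hi / lo := by ring
  · -- the weight bound
    rintro ⟨⟨d₀, d₁⟩, m⟩ hmem -
    simp only [Finset.mem_product, Finset.mem_Icc, Finset.mem_Ioc] at hmem
    obtain ⟨⟨⟨hd₀1, hd₀X⟩, hd₁lo, hd₁hi⟩, -, -⟩ := hmem
    have hd₁1 : 1 ≤ d₁ := by omega
    exact abs_moebius_log_mul_le hd₀1 hd₀X hd₁1 (hd₁hi.trans hhiXb)

end Summit.Parity.BatemanHorn.Theorems.PolyMobiusTail.EtaFreeWindow
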